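import Summits.AtomisticToContinuum.Crystallization.Theorems.FrustratedLawDichotomyStrainedPatchHomLeafTableRealHcpV

/-!
# hcp vector-form leaf checker — the CLASS IDENTITIES: moments `2A, 2B, 2C` as integer combinations of the ten class gradients

decomp-a2c hand-2 g25 (crux `AperiodicFrustratedLawGap`, stmt-AtomisticToContinuum-27623; (H) hcp P-twin, critic rows 887/891/893).  The bridge,
part 2 (integers): with `e = (2b₀ + b₁ + u, 3b₁ + u, 2b₂ + u)` and the record's class data `cls = (b₀², b₁², b₂², b₀b₁, b₀b₂, b₁b₂, 2ub₀, 2ub₁, 2ub₂, u)`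
(`u ∈ {0,1}`, so `u² = u`), `2 e_c e_c' = Σⱼ α_cc'ⱼ clsⱼ` and `2 u e_c = Σⱼ β_cⱼ clsⱼ` with the literal coefficient tables `alphaZ`, `betaZ` — exactly the
coefficients hard-wired in `…CheckHcpV.A00 … B2, C2`.  Hence, for a passing fold, ★ `A2Z_eq_sum` / `B2Z_eq_sum` / `C2_eq_sum`: the checker's moments
are the sums over the TREATED records of `D̂·2e_ce_c'`, `D̂·2ue_c`, `D̂·2u`.  0 sorry; standard axioms.  `--supports stmt-AtomisticToContinuum-27623`.
-/

namespace Summit.AtomisticToContinuum.Crystallization.Theorems.FrustratedLawDichotomyStrainedPatchHomLeafTableCheckHcpV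

open scoped BigOperators
open Finset
open Summit.AtomisticToContinuum.Crystallization.Theorems.FrustratedLawDichotomyStrainedPatchHomLeafTableCheck (Row QT sgnZ SCN natAbs_sgnZ)
open Summit.AtomisticToContinuum.Crystallization.Theorems.FrustratedLawDichotomyStrainedPatchHomLeafTableCheckHcp (NH famZ NH.ok_iff NH.cls NH.Lz NH.Lz_eq_cls)

/-! ## §1. Coefficient tables and the per-record identities -/

/-- Coefficients of `2 e_c e_c'` on the ten classes. -/
def alphaZ : Fin 3 → Fin 3 → Fin 10 → ℤ :=
  ![![![8, 2, 0, 8, 0, 0, 4, 2, 0, 2], ![0, 6, 0, 12, 0, 0, 2, 4, 0, 2], ![0, 0, 0, 0, 8, 4, 2, 1, 2, 2]],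
    ![![0, 6, 0, 12, 0, 0, 2, 4, 0, 2], ![0, 18, 0, 0, 0, 0, 0, 6, 0, 2], ![0, 0, 0, 0, 0, 12, 0, 3, 2, 2]],
    ![![0, 0, 0, 0, 8, 4, 2, 1, 2, 2], ![0, 0, 0, 0, 0, 12, 0, 3, 2, 2], ![0, 0, 8, 0, 0, 0, 0, 0, 4, 2]]]

/-- Coefficients of `2 u e_c` on the ten classes. -/
def betaZ : Fin 3 → Fin 10 → ℤ := ![![0, 0, 0, 0, 0, 0, 2, 1, 0, 2], ![0, 0, 0, 0, 0, 0, 0, 3, 0, 2], ![0, 0, 0, 0, 0, 0, 0, 0, 2, 2]]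

/-- The checker's `2A` as a function. -/
def A2Z (a : AccV) : Fin 3 → Fin 3 → ℤ := ![![A00 a, A01 a, A02 a], ![A01 a, A11 a, A12 a], ![A02 a, A12 a, A22 a]]

/-- The checker's `2B` as a function. -/
def B2Z (a : AccV) : Fin 3 → ℤ := ![B0 a, B1 a, B2 a]

set_option linter.unusedSimpArgs false in
/-- `2A_cc' = Σⱼ α_cc'ⱼ gⱼ`. [formal bookkeeping] -/
theorem A2Z_eq (a : AccV) (c c' : Fin 3) : A2Z a c c' = ∑ j : Fin 10, alphaZ c c' j * gV (a.gP j) (a.gN j) := by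
  fin_cases c <;> fin_cases c' <;>
  · simp only [A2Z, A00, A01, A02, A11, A12, A22, alphaZ, AccV.gP, AccV.gN, Int.add_def, Int.mul_def,
      Fin.sum_univ_succ, Fin.sum_univ_zero, Matrix.cons_val_zero, Matrix.cons_val_succ, Matrix.cons_val_one, Matrix.cons_val, Fin.zero_eta, Fin.isValue, Fin.mk_one, Fin.reduceFinMk]
    ring

set_option linter.unusedSimpArgs false in
/-- `2B_c = Σⱼ β_cⱼ gⱼ`. [formal bookkeeping] -/
theorem B2Z_eq (a : AccV) (c : Fin 3) : B2Z a c = ∑ j : Fin 10, betaZ c j * gV (a.gP j) (a.gN j) := by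
  fin_cases c <;>
  · simp only [B2Z, B0, B1, B2, betaZ, AccV.gP, AccV.gN, Int.add_def, Int.mul_def,
      Fin.sum_univ_succ, Fin.sum_univ_zero, Matrix.cons_val_zero, Matrix.cons_val_succ, Matrix.cons_val_one, Matrix.cons_val, Fin.zero_eta, Fin.isValue, Fin.mk_one, Fin.reduceFinMk]
    ring

/-- `2C = 2 g₉`. [formal bookkeeping] -/
theorem C2_eq (a : AccV) : C2 a = 2 * gV (a.gP 9) (a.gN 9) := by
  simp [C2, AccV.gP, AccV.gN, Int.mul_def]

/-- The per-record data behind the identities: `cls = Lz` (the `b`-products), `u = φ = famZ fam`, `φ² = φ`. [formal bookkeeping] -/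
theorem record_facts {l : NH} (hl : l.ok = true) :
    l.cls = l.Lz ∧ (l.u : ℤ) = famZ l.fam ∧ famZ l.fam * famZ l.fam = famZ l.fam := by
  obtain ⟨-, -, -, -, -, -, -, -, -, hu⟩ := (NH.ok_iff l).1 hl
  exact ⟨(NH.Lz_eq_cls hl).symm, hu, by cases l.fam <;> simp [famZ]⟩

set_option linter.unusedSimpArgs false in
/-- ★ `2 e_c e_c' = Σⱼ α_cc'ⱼ clsⱼ` for a consistent record. [formal bookkeeping] -/
theorem two_e_mul_e {l : NH} (hl : l.ok = true) (c c' : Fin 3) : 2 * (eZ l c * eZ l c') = ∑ j : Fin 10, alphaZ c c' j * l.cls j := by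
  obtain ⟨hcls, hu, hφ⟩ := record_facts hl
  rw [hcls]
  fin_cases c <;> fin_cases c' <;>
  · simp only [eZ, e0, e1, e2, alphaZ, NH.Lz, Int.add_def, Int.mul_def, hu,
      Fin.sum_univ_succ, Fin.sum_univ_zero, Matrix.cons_val_zero, Matrix.cons_val_succ, Matrix.cons_val_one, Matrix.cons_val, Fin.zero_eta, Fin.isValue, Fin.mk_one, Fin.reduceFinMk]
    linear_combination 2 * hφ

set_option linter.unusedSimpArgs false in
/-- ★ `2 u e_c = Σⱼ β_cⱼ clsⱼ` for a consistent record. [formal bookkeeping] -/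
theorem two_u_mul_e {l : NH} (hl : l.ok = true) (c : Fin 3) : 2 * ((l.u : ℤ) * eZ l c) = ∑ j : Fin 10, betaZ c j * l.cls j := by
  obtain ⟨hcls, hu, hφ⟩ := record_facts hl
  rw [hcls]
  fin_cases c <;>
  · simp only [eZ, e0, e1, e2, betaZ, NH.Lz, Int.add_def, Int.mul_def, hu,
      Fin.sum_univ_succ, Fin.sum_univ_zero, Matrix.cons_val_zero, Matrix.cons_val_succ, Matrix.cons_val_one, Matrix.cons_val, Fin.zero_eta, Fin.isValue, Fin.mk_one, Fin.reduceFinMk]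
    linear_combination 2 * hφ

/-- `2 u = 2 cls₉`. [formal bookkeeping] -/
theorem two_u {l : NH} (hl : l.ok = true) : 2 * (l.u : ℤ) = 2 * l.cls 9 := by
  obtain ⟨hcls, hu, -⟩ := record_facts hl
  rw [hcls, hu]; simp [NH.Lz]

/-! ## §2. ★ The moments of a passing fold as sums over the treated records -/

/-- A weighted class combination summed over a finset, regrouped by class. [formal bookkeeping] -/
theorem sum_mul_sum_coeff (S : Finset NH) (D : NH → ℤ) (coef : Fin 10 → ℤ) (f : NH → ℤ)
    (hf : ∀ l ∈ S, f l = ∑ j : Fin 10, coef j * l.cls j) :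
    ∑ l ∈ S, D l * f l = ∑ j : Fin 10, coef j * ∑ l ∈ S, D l * l.cls j := by
  rw [Finset.sum_congr rfl fun l hl => by rw [hf l hl]]
  simp only [Finset.mul_sum]
  rw [Finset.sum_comm]
  exact Finset.sum_congr rfl fun j _ => Finset.sum_congr rfl fun l _ => by ring

open Classical in
/-- ★ `2A_cc'` of a passing fold `= Σ_{treated} D̂ · 2 e_c e_c'`. [formal bookkeeping] -/
theorem A2Z_eq_sum {tab : QT} {k : LV} {labs : List NH} (hokA : (foldV tab k accV0 labs).ok = true) (hok : ∀ l ∈ labs, l.ok = true)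
    (hnd : labs.Nodup) (c c' : Fin 3) :
    A2Z (foldV tab k accV0 labs) c c' =
      ∑ l ∈ (labs.filter (fun l => treatedV tab k l)).toFinset, sgnZ (rowTV tab k l).sD (rowTV tab k l).aD * (2 * (eZ l c * eZ l c')) := by
  have hTnd : (labs.filter (fun l => treatedV tab k l)).Nodup := hnd.sublist List.filter_sublist
  have hmem : ∀ l ∈ (labs.filter (fun l => treatedV tab k l)).toFinset, l.ok = true :=
    fun l hl => hok l (List.filter_sublist.subset (List.mem_toFinset.1 hl))
  rw [A2Z_eq, sum_mul_sum_coeff _ _ (alphaZ c c') _ (fun l hl => two_e_mul_e (hmem l hl) c c')]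
  refine Finset.sum_congr rfl fun j _ => ?_
  rw [gV_foldV_eq hokA j, List.sum_toFinset _ hTnd]

open Classical in
/-- ★ `2B_c` of a passing fold `= Σ_{treated} D̂ · 2 u e_c`. [formal bookkeeping] -/
theorem B2Z_eq_sum {tab : QT} {k : LV} {labs : List NH} (hokA : (foldV tab k accV0 labs).ok = true) (hok : ∀ l ∈ labs, l.ok = true)
    (hnd : labs.Nodup) (c : Fin 3) :
    B2Z (foldV tab k accV0 labs) c =
      ∑ l ∈ (labs.filter (fun l => treatedV tab k l)).toFinset, sgnZ (rowTV tab k l).sD (rowTV tab k l).aD * (2 * ((l.u : ℤ) * eZ l c)) := by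
  have hTnd : (labs.filter (fun l => treatedV tab k l)).Nodup := hnd.sublist List.filter_sublist
  have hmem : ∀ l ∈ (labs.filter (fun l => treatedV tab k l)).toFinset, l.ok = true :=
    fun l hl => hok l (List.filter_sublist.subset (List.mem_toFinset.1 hl))
  rw [B2Z_eq, sum_mul_sum_coeff _ _ (betaZ c) _ (fun l hl => two_u_mul_e (hmem l hl) c)]
  refine Finset.sum_congr rfl fun j _ => ?_
  rw [gV_foldV_eq hokA j, List.sum_toFinset _ hTnd]

open Classical in
/-- ★ `2C` of a passing fold `= Σ_{treated} D̂ · 2u`. [formal bookkeeping] -/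
theorem C2_eq_sum {tab : QT} {k : LV} {labs : List NH} (hokA : (foldV tab k accV0 labs).ok = true) (hok : ∀ l ∈ labs, l.ok = true)
    (hnd : labs.Nodup) :
    C2 (foldV tab k accV0 labs) =
      ∑ l ∈ (labs.filter (fun l => treatedV tab k l)).toFinset, sgnZ (rowTV tab k l).sD (rowTV tab k l).aD * (2 * (l.u : ℤ)) := by
  have hTnd : (labs.filter (fun l => treatedV tab k l)).Nodup := hnd.sublist List.filter_sublist
  have hmem : ∀ l ∈ (labs.filter (fun l => treatedV tab k l)).toFinset, l.ok = true :=
    fun l hl => hok l (List.filter_sublist.subset (List.mem_toFinset.1 hl))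
  rw [C2_eq, gV_foldV_eq hokA 9, ← List.sum_toFinset _ hTnd, Finset.mul_sum]
  refine Finset.sum_congr rfl fun l hl => ?_
  rw [two_u (hmem l hl)]; ring

end Summit.AtomisticToContinuum.Crystallization.Theorems.FrustratedLawDichotomyStrainedPatchHomLeafTableCheckHcpV
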